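import Summits.ABC.IUTFork.Joshi.BundlingRings

/-!
# A non-vacuity model for the §7.5/§7.7 signature `PrimeBundlingDatum` (companion of `Joshi/BundlingRings.lean`)

Block E of the abc-iut cell (rung LADDER-ABC:A2.E; seat abc-iut-E-t13, slot T-13). `Joshi/BundlingRings.lean` (p429549) types
K. Joshi, *Construction of Arithmetic Teichmüller Spaces III*, arXiv:2401.13508v4 (UNREFEREED, disputed; `Joshi2024ATS3`) §7.5 /
§7.7 and DERIVES his Thm. 7.7.3.1 (at one rational prime: `PrimeBundlingDatum.localFundamentalEstimate_of_pilot_of_crossNorm`)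
from the two inputs its proof names — the per-`w` pilot lower bound `PilotLowerBoundAt ρ` ([Joshi 2023b] Thm. 9.2.1; (7.7.3.3))
and the cross-norm property `CrossNormAt ρ` ((7.7.3.2); J3 Lem. 7.6.4.1 / 7.6.5.1). This file records that those two hypotheses
are JOINTLY SATISFIABLE over the typed signature — a toy instance (all carriers `ℚ`, one place, `ℓ⋇ = 1`) in which both hold and
the derived estimate therefore holds — so the derivation is not a vacuous implication (CONVENTIONS §4 «vacuity smells»;
plan/E/README.md §5 «satisfiability check»). It says NOTHING about Joshi's actual objects (the Fargues–Fontaine rings, the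
theta-values loci) and takes no side on [IUTchIII] Cor. 3.12, on Joshi's claims or on Mochizuki's reports; typed ≠ proved ≠
endorsed. Standard axioms only; sorry-free.
-/

noncomputable section

open scoped TensorProduct

namespace Summit.ABC.IUTFork.Joshi.ATS3

namespace PrimeBundlingDatum

/-- **Toy model** of the §7.5/§7.7 signature at one rational prime: every carrier is `ℚ` (`ℚ_p`, `B_p`, one place `w` with
`E′_w = B_{E′_w} = ℚ`, tensor ring `ℚ`), `ℓ⋇ = 1`, all norms `|−|_ρ` the usual absolute value (independent of `ρ`), the pure-tensor
homomorphism = evaluation at the unique place, the comparison map `x ↦ 1 ⊗ x`, the local theta-values locus the single tuple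
`(1/2)`, and `|q_w^{1/2ℓ}| := 1/2`. Purpose: non-vacuity of the hypotheses of the derived Thm. 7.7.3.1 (below). [folklore] -/
def toyModel : PrimeBundlingDatum 1 ℚ ℚ Unit (fun _ => ℚ) (fun _ => ℚ) ℚ where
  Vp := Finset.univ
  Vss := Finset.univ
  Vss_subset := subset_rfl
  nrm := fun _ _ x => |(x : ℝ)|
  nrm_nonneg := fun _ _ x => abs_nonneg (x : ℝ)
  toTensE := fun _ => TensorProduct.mk ℚ ℚ ℚ 1
  locusBE := fun _ => {fun _ => (1 / 2 : ℚ)}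
  tprod := Pi.evalMonoidHom (fun _ : (Finset.univ : Finset Unit) => ℚ) ⟨(), Finset.mem_univ _⟩
  normT := fun _ t => |(t : ℝ)|
  normT_nonneg := fun _ t => abs_nonneg (t : ℝ)
  qRoot := fun _ => 1 / 2
  qRoot_pos := fun _ _ => by norm_num

/-- In the toy model the cross-norm property (7.7.3.2) holds at every `ρ` (a single tensor factor). [folklore] -/
theorem toyModel_crossNormAt (ρ : ℝ) : toyModel.CrossNormAt ρ := fun x =>
  (Fintype.prod_subsingleton (fun w : (Finset.univ : Finset Unit) => |(x w : ℝ)|) ⟨(), Finset.mem_univ _⟩).symm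

/-- In the toy model the per-`w` pilot lower bound (7.7.3.3) holds at every `ρ`: the locus member `(1/2)` has size
`1/2 = |q_w^{1/2ℓ}|^{ℓ⋇}`. [folklore] -/
theorem toyModel_pilotLowerBoundAt (ρ : ℝ) : toyModel.PilotLowerBoundAt ρ := by
  intro w _
  refine ⟨fun _ => (1 / 2 : ℚ), rfl, ?_⟩
  show ((1 / 2 : ℝ)) ^ 1 ≤ ∏ j : Fin 1, |(((fun _ => (1 / 2 : ℚ)) j : ℚ) : ℝ)|
  norm_num

/-- **Non-vacuity of the derived Thm. 7.7.3.1**: the toy model satisfies both inputs, hence (by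
`localFundamentalEstimate_of_pilot_of_crossNorm` at `ρ = 1`) the local fundamental estimate. [folklore] -/
theorem toyModel_localFundamentalEstimate : toyModel.LocalFundamentalEstimate :=
  toyModel.localFundamentalEstimate_of_pilot_of_crossNorm ⟨one_pos, le_rfl⟩ (toyModel_pilotLowerBoundAt 1)
    (toyModel_crossNormAt 1)

/-- The two inputs of Thm. 7.7.3.1's derivation are jointly satisfiable over the typed signature (packaged witness).
[folklore] -/
theorem inputs_satisfiable :
    ∃ D : PrimeBundlingDatum 1 ℚ ℚ Unit (fun _ => ℚ) (fun _ => ℚ) ℚ,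
      (∀ ρ : ℝ, D.PilotLowerBoundAt ρ) ∧ (∀ ρ : ℝ, D.CrossNormAt ρ) ∧ D.LocalFundamentalEstimate :=
  ⟨toyModel, toyModel_pilotLowerBoundAt, toyModel_crossNormAt, toyModel_localFundamentalEstimate⟩

end PrimeBundlingDatum

end Summit.ABC.IUTFork.Joshi.ATS3

end
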